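import Summits.AtomisticToContinuum.BoseEinsteinCondensation.Theorems.BECConjugateDominationHardCoreExtensionTruncationEnergyConvergenceAll
import Literature.Barriers.AtomisticToContinuum.KineticGapLengthScalesThermodynamicWindow
import Literature.MathematicalPhysics.QuantumManyBody.PeriodicKineticBudget
import HarnessLib

/-!
# Crux `HardCoreMomentBound` (stmt-AtomisticToContinuum-11844, route `BECNoCheapMomentum`, rank 3) —
# the crux-strategist's typed split along the TRUNCATION TOWER (glue for `route edit --split`)

Supports stmt-AtomisticToContinuum-11844. The crux reads: for every repulsive finite-range `v` with
`∫ v = ∞` (hard cores, non-integrable spikes), the sector-gap floor on the torus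
(`2E₀(N) + 2κ|k|² ≤ E_{N+1}(k) + E_{N-1}(k)` on the window `0 < |k|² ≤ Cρ`, eventually in `N`, every `C`)
implies condensation of the periodic near-minimisers (`n₀ ≥ cN` for all `δ_N`-near-minimisers, all small `ρ`).
The soft half of the same implication (integrable `v`) is the landed `momentBoundCondensation_proof`, whose only
non-soft input is the Wagner–Feynman bound with the BORN constant `2ρ‖v‖₁` — infinite here.

THE REDIRECT. Let `v_M = min(v, M)` (`M ∈ ℕ`) be the bounded truncations, `v_M ↑ v`. Two typed pieces:

* X₁ `SectorFloorTruncationTransfer` (fixed-volume spectral content): the floor for `v` transfers DOWN the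
  tower — for every `C` there are `κ, ρ₀` such that for `ρ < ρ₀`, eventually in `N`, ALL high truncations
  `v_M, M ≥ M₀(N)` obey the floor with constant `κ` on the window. Mechanism: `E₀(v_M) ≤ E₀(v)` (monotone),
  and in each of the finitely many lattice sectors of the window the sector energies of `v_M` increase to those
  of `v` (truncation = monotone convergence of forms, Rellich compactness INSIDE the Bloch sector, the sector
  version of the maximal-form bound) once the hard-core sector energies are finite (low density, `N` large);
  off the dual lattice both sides are `⊤`.
* X₂ `TruncationTowerCondensation` (the thermodynamic content, in the BOUNDED category): for hard-core `v`,
  the tower floor implies condensation of the near-minimisers of the truncations with data UNIFORM IN THE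
  TRUNCATION HEIGHT — `∃ ρ₀ ∀ ρ < ρ₀ ∃ c ∀ᶠ N ∃ δ ∀ M₁ ∃ M ≥ M₁ ∀ Ψ`, `𝓔_{v_M}[Ψ] ≤ E₀(v_M) + δ ⇒ n₀(Ψ) ≥ cN`.
  For each fixed `M` this is the landed soft theorem, but with thresholds `ρ₀ ~ ‖v_M‖₁⁻²`, `N₀(‖v_M‖₁)` that
  degenerate as `M → ∞`; X₂ asks for constants native to `(a(v_M) ≤ a(v), R₀)` — a Wagner–Feynman bound with a
  scattering-length-native constant and a slack uniform along the tower (gap/Ky-Fan stability under truncation).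
  Every object in X₂ is a bounded perturbation of the torus Laplacian: `a_k†Φ` has finite energy, Wagner's
  double-commutator identity and Jastrow conjugations are honest — the form-domain escape that makes the
  hard-core Wagner–Feynman bound untyped (`Cruxes/PeriodicIRBound`, dead line `linear_ph_floor_wagner` §6b) is gone.

ASSEMBLY `hardCoreMomentBound_of_subs : X₁ → X₂ → HardCoreMomentBound` (this file, sorry-free): spend the
floor through X₁, get the tower condensation from X₂, and pull it back to `v` by SLACK MATCHING along the
minorant tower at fixed `(N, L_N)`, `M → ∞` before `N → ∞`: below the Ruelle density `E₀(v; N, L_N) < ⊤`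
eventually (`exists_eventually_periodicGroundStateEnergy_lt_top`), the landed fixed-volume truncation energy
convergence (`stub_truncationEnergyConvergenceAll`, all admissible `v`, hard cores included) gives
`E₀(v) ≤ E₀(v_M) + δ₁/2` for large `M`, and `𝓔_{v_M}[Ψ] ≤ 𝓔_v[Ψ] ≤ E₀(v) + δ₁/2 ≤ E₀(v_M) + δ₁ ≤ E₀(v_M) + δ`
makes every `δ₁/2`-near-minimiser of `v` a `δ`-near-minimiser of a high tower level, where it condenses with
the tower's constant `c`. (Verbatim the predicate-agnostic slack matching of
`Cruxes.PeriodicIRBound.HardcoreMonotoneClassUniformity.nearMin_transfer_of_minorantTower`, private there.)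

The conclusion is the body of `Theses.BECNoCheapMomentum.HardCoreMomentBound` VERBATIM (the route file is not
imported, so that the gate can render `theorem HardCoreMomentBoundGlueBy_holds : SectorFloorTruncationTransfer →
TruncationTowerCondensation → HardCoreMomentBound := hardCoreMomentBound_of_subs` into it without an import
cycle); the two hypotheses are the bodies of the children filed with `route edit --split HardCoreMomentBound`.
No new definitions; `min (v r) M` is `truncPotential v M` unfolded.

References: [LSSY2005] §1.2 (1.17)–(1.19), App. C; [Wagner1966]; [PitaevskiiStringari1991]; [Ruelle1969] §3.5.11;
B. Simon, J. Operator Theory 1 (1979) 37–47 (monotone convergence of forms); [ReedSimonIV1978] Thm XIII.64.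
-/

noncomputable section

open MeasureTheory Filter
open scoped ENNReal NNReal BigOperators

namespace Summit.AtomisticToContinuum.BoseEinsteinCondensation.TruncationTower

open Literature.MathematicalPhysics.QuantumManyBody.BoseGas

/-- **Slack transfer along a tower of minorants, for an arbitrary predicate** (fixed volume). At fixed
`(N, L)`: if `wₙ ≤ v` pointwise, `E₀(v) ≤ E₀(wₙ) + ε` for all large `n` (every `ε > 0`), and ONE slack
`δ > 0` makes, for arbitrarily large levels `n`, every `δ`-near-minimiser of `wₙ` satisfy `Q`, then every
`δ'`-near-minimiser of `v` satisfies `Q` for `δ' = min(δ,1)/2 > 0`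
(`E_{wₙ} Ψ ≤ E_v Ψ ≤ E₀(v) + δ' ≤ E₀(wₙ) + 2δ' ≤ E₀(wₙ) + δ`). [cite: LSSY2005, §1.2 (1.17)–(1.19)] -/
theorem nearMin_transfer_of_minorantTower {N : ℕ} {L : ℝ} (v : ℝ → ℝ≥0∞)
    (w : ℕ → ℝ → ℝ≥0∞) (Q : PeriodicTrialState N L → Prop)
    (hwv : ∀ n r, w n r ≤ v r)
    (hconv : ∀ ε : ℝ, 0 < ε → ∃ n₁ : ℕ, ∀ n : ℕ, n₁ ≤ n →
      periodicGroundStateEnergy v N L ≤ periodicGroundStateEnergy (w n) N L + ENNReal.ofReal ε)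
    {δ : ℝ≥0∞} (hδ : 0 < δ)
    (h : ∀ n₁ : ℕ, ∃ n : ℕ, n₁ ≤ n ∧ ∀ Ψ : PeriodicTrialState N L,
      periodicEnergy (w n) Ψ ≤ periodicGroundStateEnergy (w n) N L + δ → Q Ψ) :
    ∃ δ' : ℝ≥0∞, 0 < δ' ∧ ∀ Ψ : PeriodicTrialState N L,
      periodicEnergy v Ψ ≤ periodicGroundStateEnergy v N L + δ' → Q Ψ := by
  -- adapted from `Cruxes.PeriodicIRBound.HardcoreMonotoneClassUniformity.nearMin_transfer_of_minorantTower`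
  set δ₁ : ℝ≥0∞ := min δ 1 with hδ₁
  have hδ₁pos : 0 < δ₁ := lt_min hδ one_pos
  have hδ₁top : δ₁ ≠ ⊤ := ne_top_of_le_ne_top ENNReal.one_ne_top (min_le_right _ _)
  have hδ₁le : δ₁ ≤ δ := min_le_left _ _
  have hhalf_ne : δ₁ / 2 ≠ 0 := (ENNReal.half_pos hδ₁pos.ne').ne'
  have hhalf_top : δ₁ / 2 ≠ ⊤ := ENNReal.div_ne_top hδ₁top two_ne_zero
  set ε : ℝ := (δ₁ / 2).toReal with hε
  have hεpos : 0 < ε := ENNReal.toReal_pos hhalf_ne hhalf_top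
  have hεeq : ENNReal.ofReal ε = δ₁ / 2 := ENNReal.ofReal_toReal hhalf_top
  obtain ⟨n₁, hn₁⟩ := hconv ε hεpos
  obtain ⟨n, hn, hQ⟩ := h n₁
  refine ⟨δ₁ / 2, ENNReal.half_pos hδ₁pos.ne', fun Ψ hΨ => hQ Ψ ?_⟩
  calc periodicEnergy (w n) Ψ ≤ periodicEnergy v Ψ := periodicEnergy_mono_of_le (hwv n) Ψ
    _ ≤ periodicGroundStateEnergy v N L + δ₁ / 2 := hΨ
    _ ≤ periodicGroundStateEnergy (w n) N L + ENNReal.ofReal ε + δ₁ / 2 := by gcongr; exact hn₁ n hn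
    _ = periodicGroundStateEnergy (w n) N L + δ₁ := by rw [hεeq, add_assoc, ENNReal.add_halves]
    _ ≤ periodicGroundStateEnergy (w n) N L + δ := by gcongr

/-- **Tower condensation transfers to the potential itself** (the per-potential assembly step). For an
admissible `v` (hard cores allowed): if below `ρ₀`, with a constant `c(ρ)`, eventually in `N`, ONE slack `δ_N`
makes the `δ_N`-near-minimisers of arbitrarily high truncations `min(v, M)` condense (`n₀ ≥ cN`), then below
`min ρ₀ ρ₁(v)` (`ρ₁` = Ruelle finiteness density) the `δ'_N`-near-minimisers of `v` condense with the same
`c`: fixed-volume truncation energy convergence + slack matching along the minorant tower.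
[cite: LSSY2005, §1.2 (1.17)–(1.19); Ruelle1969, §3.5.11] -/
theorem periodicBEC_of_towerBEC {v : ℝ → ℝ≥0∞} (hv : IsRepulsiveFiniteRange v)
    (hT : ∃ ρ₀ : ℝ, 0 < ρ₀ ∧ ∀ ρ : ℝ, 0 < ρ → ρ < ρ₀ → ∃ c : ℝ, 0 < c ∧ ∀ᶠ N : ℕ in atTop,
      ∃ δ : ℝ≥0∞, 0 < δ ∧ ∀ M₁ : ℕ, ∃ M : ℕ, M₁ ≤ M ∧
        ∀ Ψ : PeriodicTrialState N (sideLength ρ N),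
          periodicEnergy (fun r => min (v r) (M : ℝ≥0∞)) Ψ ≤
              periodicGroundStateEnergy (fun r => min (v r) (M : ℝ≥0∞)) N (sideLength ρ N) + δ →
            ENNReal.ofReal (c * N) ≤ condensateOccupation N (sideLength ρ N) Ψ.ψ) :
    ∃ ρ₀ : ℝ, 0 < ρ₀ ∧ ∀ ρ : ℝ, 0 < ρ → ρ < ρ₀ → ∃ c : ℝ, 0 < c ∧ ∀ᶠ N : ℕ in atTop,
      ∃ δ : ℝ≥0∞, 0 < δ ∧ ∀ Ψ : PeriodicTrialState N (sideLength ρ N),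
        periodicEnergy v Ψ ≤ periodicGroundStateEnergy v N (sideLength ρ N) + δ →
          ENNReal.ofReal (c * N) ≤ condensateOccupation N (sideLength ρ N) Ψ.ψ := by
  obtain ⟨ρ₀, hρ₀, hbec⟩ := hT
  obtain ⟨ρF, hρF, hfin⟩ :=
    Literature.Barriers.AtomisticToContinuum.BoseGas.exists_eventually_periodicGroundStateEnergy_lt_top hv
  refine ⟨min ρ₀ ρF, lt_min hρ₀ hρF, fun ρ hρ hρlt => ?_⟩
  obtain ⟨c, hc, hev⟩ := hbec ρ hρ (hρlt.trans_le (min_le_left _ _))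
  refine ⟨c, hc, ?_⟩
  filter_upwards [hev, hfin ρ hρ (hρlt.trans_le (min_le_right _ _)), eventually_gt_atTop 0] with N hN
    hEfin hNpos
  obtain ⟨δ, hδ, htower⟩ := hN
  have hL : 0 < sideLength ρ N := sideLength_pos_of_pos hρ hNpos
  exact nearMin_transfer_of_minorantTower v (fun M r => min (v r) (M : ℝ≥0∞))
    (fun Ψ : PeriodicTrialState N (sideLength ρ N) =>
      ENNReal.ofReal (c * N) ≤ condensateOccupation N (sideLength ρ N) Ψ.ψ)
    (fun _ _ => min_le_left _ _)
    (fun ε hε =>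
      Summit.AtomisticToContinuum.BoseEinsteinCondensation.Cruxes.HardCoreExtension.ThirdLawCurrentFloorAlt.stub_truncationEnergyConvergenceAll
        v hv N _ hL hEfin.ne ε hε)
    hδ htower

/-- **The typed split of `HardCoreMomentBound` (stmt-AtomisticToContinuum-11844): X₁ → X₂ → crux.**
Hypothesis 1 is the body of the child `SectorFloorTruncationTransfer` (the sector-gap floor of a hard-core `v`
transfers to all high truncations `min(v, M)`, eventually in `N`); hypothesis 2 is the body of the child
`TruncationTowerCondensation` (for hard-core `v`, the tower floor gives condensation of the near-minimisers of the
truncations with density threshold, constant and slack uniform in the truncation height); the conclusion is the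
body of `Theses.BECNoCheapMomentum.HardCoreMomentBound` verbatim. Proof: `periodicBEC_of_towerBEC` applied to
`h₂ v hv h⊤ (h₁ v hv h⊤ hfloor)`. [cite: LSSY2005, §1.2 (1.17)–(1.19); Wagner1966; PitaevskiiStringari1991] -/
theorem hardCoreMomentBound_of_subs :
    (∀ v : ℝ → ℝ≥0∞, IsRepulsiveFiniteRange v → (∫⁻ x : EuclideanSpace ℝ (Fin 3), v ‖x‖) = ⊤ →
      (∀ C : ℝ, 0 < C → ∃ κ : ℝ, 0 < κ ∧ ∃ ρ₀ : ℝ, 0 < ρ₀ ∧ ∀ ρ : ℝ, 0 < ρ → ρ < ρ₀ →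
        ∀ᶠ N : ℕ in Filter.atTop, ∀ k : EuclideanSpace ℝ (Fin 3), k ≠ 0 → ‖k‖ ^ 2 ≤ C * ρ →
          2 * periodicGroundStateEnergy v N (sideLength ρ N) + ENNReal.ofReal (2 * κ * ‖k‖ ^ 2) ≤
            (⨅ (Ψ : PeriodicTrialState (N + 1) (sideLength ρ N)) (_ : ∀ (s : EuclideanSpace ℝ (Fin 3))
              (X : Fin (N + 1) → EuclideanSpace ℝ (Fin 3)),
              Ψ.ψ (fun i => X i + s) = Complex.exp (Complex.I * ↑(∑ j, k j * s j)) * Ψ.ψ X),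
              periodicEnergy v Ψ) +
            (⨅ (Ψ : PeriodicTrialState (N - 1) (sideLength ρ N)) (_ : ∀ (s : EuclideanSpace ℝ (Fin 3))
              (X : Fin (N - 1) → EuclideanSpace ℝ (Fin 3)),
              Ψ.ψ (fun i => X i + s) = Complex.exp (Complex.I * ↑(∑ j, k j * s j)) * Ψ.ψ X),
              periodicEnergy v Ψ)) →
      ∀ C : ℝ, 0 < C → ∃ κ : ℝ, 0 < κ ∧ ∃ ρ₀ : ℝ, 0 < ρ₀ ∧ ∀ ρ : ℝ, 0 < ρ → ρ < ρ₀ →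
        ∀ᶠ N : ℕ in Filter.atTop, ∃ M₀ : ℕ, ∀ M : ℕ, M₀ ≤ M →
          ∀ k : EuclideanSpace ℝ (Fin 3), k ≠ 0 → ‖k‖ ^ 2 ≤ C * ρ →
          2 * periodicGroundStateEnergy (fun r => min (v r) (M : ℝ≥0∞)) N (sideLength ρ N) +
              ENNReal.ofReal (2 * κ * ‖k‖ ^ 2) ≤
            (⨅ (Ψ : PeriodicTrialState (N + 1) (sideLength ρ N)) (_ : ∀ (s : EuclideanSpace ℝ (Fin 3))
              (X : Fin (N + 1) → EuclideanSpace ℝ (Fin 3)),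
              Ψ.ψ (fun i => X i + s) = Complex.exp (Complex.I * ↑(∑ j, k j * s j)) * Ψ.ψ X),
              periodicEnergy (fun r => min (v r) (M : ℝ≥0∞)) Ψ) +
            (⨅ (Ψ : PeriodicTrialState (N - 1) (sideLength ρ N)) (_ : ∀ (s : EuclideanSpace ℝ (Fin 3))
              (X : Fin (N - 1) → EuclideanSpace ℝ (Fin 3)),
              Ψ.ψ (fun i => X i + s) = Complex.exp (Complex.I * ↑(∑ j, k j * s j)) * Ψ.ψ X),
              periodicEnergy (fun r => min (v r) (M : ℝ≥0∞)) Ψ)) →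
    (∀ v : ℝ → ℝ≥0∞, IsRepulsiveFiniteRange v → (∫⁻ x : EuclideanSpace ℝ (Fin 3), v ‖x‖) = ⊤ →
      (∀ C : ℝ, 0 < C → ∃ κ : ℝ, 0 < κ ∧ ∃ ρ₀ : ℝ, 0 < ρ₀ ∧ ∀ ρ : ℝ, 0 < ρ → ρ < ρ₀ →
        ∀ᶠ N : ℕ in Filter.atTop, ∃ M₀ : ℕ, ∀ M : ℕ, M₀ ≤ M →
          ∀ k : EuclideanSpace ℝ (Fin 3), k ≠ 0 → ‖k‖ ^ 2 ≤ C * ρ →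
          2 * periodicGroundStateEnergy (fun r => min (v r) (M : ℝ≥0∞)) N (sideLength ρ N) +
              ENNReal.ofReal (2 * κ * ‖k‖ ^ 2) ≤
            (⨅ (Ψ : PeriodicTrialState (N + 1) (sideLength ρ N)) (_ : ∀ (s : EuclideanSpace ℝ (Fin 3))
              (X : Fin (N + 1) → EuclideanSpace ℝ (Fin 3)),
              Ψ.ψ (fun i => X i + s) = Complex.exp (Complex.I * ↑(∑ j, k j * s j)) * Ψ.ψ X),
              periodicEnergy (fun r => min (v r) (M : ℝ≥0∞)) Ψ) +
            (⨅ (Ψ : PeriodicTrialState (N - 1) (sideLength ρ N)) (_ : ∀ (s : EuclideanSpace ℝ (Fin 3))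
              (X : Fin (N - 1) → EuclideanSpace ℝ (Fin 3)),
              Ψ.ψ (fun i => X i + s) = Complex.exp (Complex.I * ↑(∑ j, k j * s j)) * Ψ.ψ X),
              periodicEnergy (fun r => min (v r) (M : ℝ≥0∞)) Ψ)) →
      ∃ ρ₀ : ℝ, 0 < ρ₀ ∧ ∀ ρ : ℝ, 0 < ρ → ρ < ρ₀ → ∃ c : ℝ, 0 < c ∧ ∀ᶠ N : ℕ in Filter.atTop,
        ∃ δ : ℝ≥0∞, 0 < δ ∧ ∀ M₁ : ℕ, ∃ M : ℕ, M₁ ≤ M ∧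
          ∀ Ψ : PeriodicTrialState N (sideLength ρ N),
            periodicEnergy (fun r => min (v r) (M : ℝ≥0∞)) Ψ ≤
                periodicGroundStateEnergy (fun r => min (v r) (M : ℝ≥0∞)) N (sideLength ρ N) + δ →
              ENNReal.ofReal (c * N) ≤ condensateOccupation N (sideLength ρ N) Ψ.ψ) →
    (∀ v : ℝ → ℝ≥0∞, IsRepulsiveFiniteRange v → (∫⁻ x : EuclideanSpace ℝ (Fin 3), v ‖x‖) = ⊤ →
      (∀ C : ℝ, 0 < C → ∃ κ : ℝ, 0 < κ ∧ ∃ ρ₀ : ℝ, 0 < ρ₀ ∧ ∀ ρ : ℝ, 0 < ρ → ρ < ρ₀ →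
        ∀ᶠ N : ℕ in Filter.atTop, ∀ k : EuclideanSpace ℝ (Fin 3), k ≠ 0 → ‖k‖ ^ 2 ≤ C * ρ →
          2 * periodicGroundStateEnergy v N (sideLength ρ N) + ENNReal.ofReal (2 * κ * ‖k‖ ^ 2) ≤
            (⨅ (Ψ : PeriodicTrialState (N + 1) (sideLength ρ N)) (_ : ∀ (s : EuclideanSpace ℝ (Fin 3))
              (X : Fin (N + 1) → EuclideanSpace ℝ (Fin 3)),
              Ψ.ψ (fun i => X i + s) = Complex.exp (Complex.I * ↑(∑ j, k j * s j)) * Ψ.ψ X),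
              periodicEnergy v Ψ) +
            (⨅ (Ψ : PeriodicTrialState (N - 1) (sideLength ρ N)) (_ : ∀ (s : EuclideanSpace ℝ (Fin 3))
              (X : Fin (N - 1) → EuclideanSpace ℝ (Fin 3)),
              Ψ.ψ (fun i => X i + s) = Complex.exp (Complex.I * ↑(∑ j, k j * s j)) * Ψ.ψ X),
              periodicEnergy v Ψ)) →
      ∃ ρ₀ : ℝ, 0 < ρ₀ ∧ ∀ ρ : ℝ, 0 < ρ → ρ < ρ₀ → ∃ c : ℝ, 0 < c ∧ ∀ᶠ N : ℕ in Filter.atTop,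
        ∃ δ : ℝ≥0∞, 0 < δ ∧ ∀ Ψ : PeriodicTrialState N (sideLength ρ N),
          periodicEnergy v Ψ ≤ periodicGroundStateEnergy v N (sideLength ρ N) + δ →
            ENNReal.ofReal (c * N) ≤ condensateOccupation N (sideLength ρ N) Ψ.ψ) :=
  fun h₁ h₂ v hv htop hfloor => periodicBEC_of_towerBEC hv (h₂ v hv htop (h₁ v hv htop hfloor))

end Summit.AtomisticToContinuum.BoseEinsteinCondensation.TruncationTower

end
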